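import Summits.BirchSwinnertonDyer.Rank1Residual.F1Sign2.TamagawaExponentAtTwo
import Summits.BirchSwinnertonDyer.Rank1Residual.F1Sign2.RealComponentAtTwo
import Mathlib.NumberTheory.Padics.PadicNumbers
import HarnessLib.Audit.Tags
import HarnessLib

/-!
# Cell `bsd-f1-sign2` — Euler-system lens (planner `-es` g27; MEMO-es §36, CensusES36.md): ES-36 — THE SELMER TERM OF THE 2-ADIC FLOOR OF THE
# MODULAR DEGREE IS THE EVEN-TAMAGAWA-RELAXED 2-SELMER GROUP; THE ARCHIMEDEAN PLACE IS ONE OF THE RELAXED PLACES.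

STATEMENTS ONLY (crux workfile of `stmt-BirchSwinnertonDyer-23715`, `RankOneAtTwoBigImageOddLocal`; nothing here is a theorem beyond print; BSD is not proved).

THE LAW (informal, all of it measured at `4 ∤ N`).  For an optimal `E/ℚ` with `E(ℚ)[2] = 0` and `Δ_E` not a square (`ρ̄_{E,2}` surjective) put
`S(E) := {v ≤ ∞ : the local Tamagawa number c_v(E) is EVEN}`, `c_∞ := #π₀(E(ℝ)) = 1 + [Δ_E > 0]`; for a multiplicative prime `q ∥ N`,
`c_q` even ⟺ `v_q(Δ_E)` even ⟺ `E[2]` unramified at `q` («tier β»), and `E[2] ⊂ E(ℚ_q)` («tier γ») ⟺ `c₄Δ_E ∈ ℚ_q^{×2}`.  Let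
`Sel₂^{S}(E) ⊇ Sel₂(E)` be the 2-Selmer group with the local conditions at `v ∈ S(E)` DROPPED.  Then
  (ES-36)   `v₂(m_E) ≥ ω(N) − 1 + dim_{𝔽₂} Sel₂^{S(E)}(E)`,
and by Poitou–Tate `dim Sel₂^{S} = dim Sel₂ + Σ_{v ∈ S} d_v − rk(Sel₂ → ⊕_{v∈S} E(ℚ_v)/2)`, `d_∞ = [Δ>0]`, `d_q = 1 + [tier γ]` (`q` odd or `q = 2`).
CONSEQUENCES TYPED BELOW (each with its own census; hypotheses printed verbatim in the docstrings):
* ES-36A `IdentityComponentDivisibilityAtTwo` — ON THE CRUX SLICE (odd Tamagawa ⟹ `S(E) ⊆ {∞}`): rank one, `Δ > 0`, `4 ∤ N`, generator on the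
  identity real component ⟹ `2^{ω(N)+1} ∣ m_E` (one power of `2` MORE than ES-35A's real bit).  39 851 / 39 851 rank-one optimal curves `N < 5·10⁵`.
* ES-36B `MordellWeilRealComponentDivisibilityAtTwo` — all ranks, `4 ∤ N`: `2^{ω(N) − 1 + r + [Δ>0 ∧ E(ℚ) ⊂ E⁰(ℝ)]} ∣ m_E`.  645 252 / 645 252 (`r ≥ 1`).
* ES-36C `EvenTamagawaDivisibilityAtTwo` — SEMISTABLE, rank-free, purely local: `2^{ω(N) − 1 + [Δ>0] + #β(E) + 2·#γ(E)} ∣ m_E`.  431 171 / 431 171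
  optimal semistable curves `N < 5·10⁵` (all ranks), floor attained 68 125 times and in every `([Δ>0], #β, #γ)` cell.
* ES-36D `EvenTamagawaRankDivisibilityAtTwo` — semistable: `2^{ω(N) − 1 + max(r, [Δ>0] + #β + 2#γ)} ∣ m_E`.  431 171 / 431 171.
* ES-36E `UnifiedEvenTamagawaDivisibilityAtTwo` — all `4 ∤ N`: additive primes `p` (odd) with `c_p` even weigh `2`: `2^{ω(N) − 1 + max(r, σ⁺(E))} ∣ m_E`,
  `σ⁺ = [Δ>0] + #β + 2#γ + 2·#{p² ∣ N : c_p even}`.  431 171 + 368 675 = 799 846 / 799 846 optimal curves `N < 5·10⁵` (one additive prime; ≥ 2 untested).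
* ES-36F `HalvableClassesDivisibilityAtTwo` — semistable, RANK-FREE: `2^{ω(N) − 1 + σ(E)} · #{c ∈ E(ℚ)/2E(ℚ) : c ∈ 2E(ℚ_v) ∀ v ∈ S(E)} ∣ m_E`
  (halving quartics; = `ω − 1 + r + σ − rk_F`).  301 915 / 301 915 optimal semistable `r ≥ 1` curves `N < 5·10⁵` (incl. `2 ∈ S`).
* ES-36G `PlacewiseHalvingDivisibilityAtTwo` — semistable, `2 ∉ S`: `2^{ω(N) − 1 + r + σ(E) − #{v ∈ S : E(ℚ) ⊄ 2E(ℚ_v)}} ∣ m_E` (a place absorbs ≤ 1).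
  166 294 / 166 294; F ∧ G attained in 75/75 cells; with cap `κ₂ = d₂` at `q = 2` also 87 006 / 87 006, 79/79 cells.
* ES-36H `TamagawaLengthAbsorptionDivisibilityAtTwo` (v4, law U, after REF1 S338 / REF2 R59b) — semistable, RANK-FREE, Tamagawa 2-LENGTH weights
  `Σ ord₂ c_q` and an explicit absorbing quotient `A_v ⊂ E(ℚ_v)/2E(ℚ_v)` per place: 431 171 / 431 171 (all ranks), pointwise ≥ ES-36C/F/G and REF1's `L♯`.
KERNEL GLUE: `evenTamagawa_of_halvableClasses` (36F ⟹ 36C), `evenTamagawa_of_rank` (36D ⟹ 36C), `identityComponent_of_mordellWeil` (36B ∧ «analytic rank 1 ⟹ rank 1 on the slice» ⟹ 36A).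
-/

open scoped Classical AddSubgroup

noncomputable section

set_option linter.dupNamespace false
set_option autoImplicit false

namespace Summit.BirchSwinnertonDyer.BirchSwinnertonDyer.Theorems.RankOneAtTwoRelaxedSelmer

open Literature.NumberTheory.EllipticCurves Literature.NumberTheory.EllipticCurves.ModularForms WeierstrassCurve
open Summit.BirchSwinnertonDyer.Rank1Residual.F1Sign2 (MeetsEgg OnEgg NoRationalTwoTorsion)

/-- `x ∈ ℚ` is a square in `ℚ_q`. -/
def IsPadicSquare (q : ℕ) [Fact q.Prime] (x : ℚ) : Prop := IsSquare ((x : ℚ_[q]))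

/-- The ARCHIMEDEAN even-Tamagawa bit: `[c_∞(E) = 2] = [Δ_E > 0]` (`E(ℝ)` has two components iff the minimal discriminant is positive). -/
def realComponentBit (W : WeierstrassCurve ℚ) : ℕ := if 0 < W.Δ then 1 else 0

/-- Tier β ∪ γ: the multiplicative primes `q ∥ N` (`q ∣ N`, `q² ∤ N`) at which the minimal discriminant has EVEN valuation — equivalently `E[2]`
is unramified at `q`, equivalently the Tamagawa number `c_q` is even (split `I_n`: `c_q = n = v_q(Δ)`; non-split: `c_q = 2` iff `n` even). -/
def evenTamagawaMultPrimes (W : WeierstrassCurve ℚ) : Finset ℕ :=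
  (W.conductorNorm ℤ).primeFactors.filter (fun q => ¬ q ^ 2 ∣ W.conductorNorm ℤ ∧ Even (padicValRat q W.Δ))

/-- Tier γ: the multiplicative primes `q ∥ N` with FULL local 2-torsion `E[2] ⊂ E(ℚ_q)` — for the Tate curve, `Q ∈ ℚ_q^{×2}`, equivalently
`j_E ∈ ℚ_q^{×2}`, equivalently `c₄·Δ` is a square in `ℚ_q` (then `v_q(Δ)` is automatically even, so γ ⊆ β ∪ γ). -/
def fullTwoTorsionMultPrimes (W : WeierstrassCurve ℚ) : Finset ℕ :=
  (W.conductorNorm ℤ).primeFactors.filter (fun q => ¬ q ^ 2 ∣ W.conductorNorm ℤ ∧ ∃ hq : q.Prime, @IsPadicSquare q ⟨hq⟩ (W.c₄ * W.Δ))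

/-- The EVEN-TAMAGAWA SIGNATURE `σ(E) := [Δ>0] + #(β ∪ γ) + #γ = Σ_{v ∈ S(E)} d_v` — the total dimension of the local Kummer images at the
even-Tamagawa places (`d_∞ = 1`, `d_q = dim E(ℚ_q)/2E(ℚ_q) ∩ component directions = 1 + [γ]`). -/
def evenTamagawaSignature (W : WeierstrassCurve ℚ) : ℕ :=
  realComponentBit W + (evenTamagawaMultPrimes W).card + (fullTwoTorsionMultPrimes W).card

/-- **ES-36C `EvenTamagawaDivisibilityAtTwo` — THE PURELY LOCAL LAW (semistable).**  For an OPTIMAL semistable `E/ℚ` (conductor `N` squarefree)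
with `E(ℚ)[2] = 0` and `Δ_E` not a rational square (⟺ `ρ̄_{E,2}` surjective): `2^{ω(N) − 1 + [Δ_E>0] + #{q ∣ N : 2 ∣ v_q(Δ_E)} + #{q ∣ N : E[2] ⊂ E(ℚ_q)}} ∣ m_E`.
Every EVEN local Tamagawa number (`c_∞ = 2`, `c_q` even) adds one power of `2` to the Atkin–Lehner floor `2^{ω(N)−1}`, a prime with full local
`2`-torsion adds two; no Selmer group, no rank, no generator enters.
CENSUS (ENGINE 36h, Cremona `allcurves ⨝ alldegphi`, curve #1 of each class, ALL `N < 5·10⁵`): **431 171 / 431 171, 0 exceptions** (rank 0: 129 256, rank 1: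
214 816, rank 2: 82 783, rank 3: 4 315, rank 4: 1); floor ATTAINED 68 125 times (15.8 %), and in every cell: `([Δ>0],#β,#γ) = (0,0,0)` 34.0 %, `(0,1,0)` 16.6 %,
`(0,0,1)` 22.1 %, `(0,2,0)` 12.6 %, `(1,0,0)` 35.3 %, `(1,1,0)` 25.4 %, `(1,0,1)` 25.8 %, `(0,1,1)` 14.3 % … (rank 0); by range `N ≤ 10⁴` 8 826/0, `10⁴–10⁵`
83 179/0, `10⁵–5·10⁵` 339 166/0.  MUTATIONS: weight `2` instead of `1` at a tier-β prime `q = 2` (full `H¹(ℚ₂, E[2])`-relaxation) is REFUTED 1 629× (`N ≤ 10⁵`);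
the floor is not implied by print: Dummigan–Krishnamoorthy 2013 Prop. 2.1 / Calegari–Emerton 2009 §2 give `ω(N) − 1 + [w_p = +1 ∀ p]` only.
Why it might fail: a semistable curve beyond `5·10⁵` with two tier-γ primes whose level-lowered congruences are dependent; `E(ℚ)[2] = 0` is load-bearing.
[cite: Watkins2002, Conj. 4.1 and §4.2] [cite: Dummigan2006, §2 hypotheses (2),(4)] [cite: DummiganKrishnamoorthy2013, Prop. 2.1] -/
@[conjecture] def EvenTamagawaDivisibilityAtTwo : Prop :=
  ∀ (W : WeierstrassCurve ℚ) [W.IsElliptic] [W.IsGloballyMinimal] [NeZero (W.conductorNorm ℤ)]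
    (D : ModularParametrizationData W (W.conductorNorm ℤ)),
    (∀ (W'' : WeierstrassCurve ℚ) [W''.IsElliptic] (D'' : ModularParametrizationData W'' (W.conductorNorm ℤ)),
        D''.f = D.f → D.modularDegree ≤ D''.modularDegree) →
    Squarefree (W.conductorNorm ℤ) → Nat.card (W.toAffine.Point[(2 : ℤ)]) = 1 → ¬ IsSquare W.Δ →
    2 ^ ((W.conductorNorm ℤ).primeFactors.card - 1 + evenTamagawaSignature W) ∣ D.modularDegree

/-- **ES-36D `EvenTamagawaRankDivisibilityAtTwo` (semistable, with the rank).**  Same hypotheses: `2^{ω(N) − 1 + max(rank E(ℚ), σ(E))} ∣ m_E`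
(`= dim Sel₂^{S}` lower bound `max(dim Sel₂, Σ d_v)`; the rank branch alone is Watkins' conjecture + Atkin–Lehner, ES-32B♯).
CENSUS ENGINE 36h: **431 171 / 431 171**, floor attained 92 160 times (rank 0: 23.9 %, rank 1: 21.5 %, rank 2: 17.4 %, rank 3: 17.5 %).
Why it might fail: as 36C; or a rank-4 semistable curve with `σ = 0` and `v₂(m_E) = ω + 2`. [cite: Watkins2002, Conj. 4.1] [cite: Dummigan2006, §2] -/
@[conjecture] def EvenTamagawaRankDivisibilityAtTwo : Prop :=
  ∀ (W : WeierstrassCurve ℚ) [W.IsElliptic] [W.IsGloballyMinimal] [NeZero (W.conductorNorm ℤ)]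
    (D : ModularParametrizationData W (W.conductorNorm ℤ)),
    (∀ (W'' : WeierstrassCurve ℚ) [W''.IsElliptic] (D'' : ModularParametrizationData W'' (W.conductorNorm ℤ)),
        D''.f = D.f → D.modularDegree ≤ D''.modularDegree) →
    Squarefree (W.conductorNorm ℤ) → Nat.card (W.toAffine.Point[(2 : ℤ)]) = 1 → ¬ IsSquare W.Δ →
    2 ^ ((W.conductorNorm ℤ).primeFactors.card - 1 + max W.mordellWeilRank (evenTamagawaSignature W)) ∣ D.modularDegree

/-- Weight of a bad prime `p` in the UNIFIED even-Tamagawa signature (engines 36h + 36k): `0` if `c_p` is odd; if `c_p = [E(ℚ_p) : E₀(ℚ_p)]` is even: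
`2` when `p² ∣ N` (additive, `p` odd since `4 ∤ N`), `2` when `p ∥ N` and `E[2] ⊂ E(ℚ_p)` (tier γ: `c₄Δ ∈ ℚ_p^{×2}`), else `1` (tier β).
`c_p` is the tree's `localTamagawaNumber` over `ℤ_[p]` (`Literature/NumberTheory/EllipticCurves/Tamagawa.lean`). -/
def evenTamagawaWeightAt (W : WeierstrassCurve ℚ) (p : ℕ) : ℕ :=
  if hp : p.Prime then
    (haveI : Fact p.Prime := ⟨hp⟩
     if Even ((W.baseChange ℚ_[p]).localTamagawaNumber ℤ_[p]) then
       (if p ^ 2 ∣ W.conductorNorm ℤ then 2 else if IsPadicSquare p (W.c₄ * W.Δ) then 2 else 1)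
     else 0)
  else 0

/-- UNIFIED even-Tamagawa signature at `4 ∤ N`: `σ⁺(E) := [Δ > 0] + Σ_{p ∣ N} evenTamagawaWeightAt E p`
(`= σ(E)` of `evenTamagawaSignature` on semistable curves, by `c_q ≡ v_q(Δ) (mod 2)` at multiplicative `q`). -/
def unifiedEvenTamagawaSignature (W : WeierstrassCurve ℚ) : ℕ :=
  realComponentBit W + ∑ p ∈ (W.conductorNorm ℤ).primeFactors, evenTamagawaWeightAt W p

/-- **ES-36E `UnifiedEvenTamagawaDivisibilityAtTwo` (all `4 ∤ N`, rank-free).**  For an optimal `E/ℚ` with `4 ∤ N`, no CM, `E(ℚ)[2] = 0`,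
`Δ ∉ ℚ^{×2}`:  `2^{ω(N) − 1 + max(rank E(ℚ), σ⁺(E))} ∣ m_E`, `σ⁺` = `unifiedEvenTamagawaSignature` (∞ ↦ 1, β ↦ 1, γ ↦ 2, additive `p` with `c_p` even ↦ 2).
CENSUS: semistable part = ENGINE 36h (431 171 / 431 171); curves with exactly one additive (odd) prime and unambiguous `c_p`-parity = ENGINE 36k:
**368 675 / 368 675** (`c_p` even: 201 894 rows, floor attained 16 630 times ≈ 8 %; `c_p` odd: 166 781 rows, attained 30 298 times), all `N < 5·10⁵`;
true-Selmer max form with additive weight 2 at `N ≤ 10⁵` (ENGINE 36j): 195 414 / 195 414.  NOT TESTED: curves with ≥ 2 additive odd primes (161 922) or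
ambiguous `c_p` parity (45 957).  Finer additive weights are visible (I_n^*: `3 + v₂(n)`, engine 36g2) but not claimed.
Why it might fail: a curve with two additive primes of type I₀^* (c = 2 each) where the two weight-2 contributions do not stack. [cite: Watkins2002, Conj. 4.1] [cite: Dummigan2006, §2] -/
@[conjecture] def UnifiedEvenTamagawaDivisibilityAtTwo : Prop :=
  ∀ (W : WeierstrassCurve ℚ) [W.IsElliptic] [W.IsGloballyMinimal] [NeZero (W.conductorNorm ℤ)]
    (D : ModularParametrizationData W (W.conductorNorm ℤ)),
    (∀ (W'' : WeierstrassCurve ℚ) [W''.IsElliptic] (D'' : ModularParametrizationData W'' (W.conductorNorm ℤ)),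
        D''.f = D.f → D.modularDegree ≤ D''.modularDegree) →
    ¬ 4 ∣ W.conductorNorm ℤ → ¬ W.HasCM → Nat.card (W.toAffine.Point[(2 : ℤ)]) = 1 → ¬ IsSquare W.Δ →
    2 ^ ((W.conductorNorm ℤ).primeFactors.card - 1 + max W.mordellWeilRank (unifiedEvenTamagawaSignature W)) ∣ D.modularDegree


/-- **ES-36B `MordellWeilRealComponentDivisibilityAtTwo` — THE ARCHIMEDEAN RELAXED PLACE MEETS THE MORDELL–WEIL GROUP (`4 ∤ N`, all ranks).**
For an OPTIMAL `E/ℚ` with `4 ∤ N`, no CM, `E(ℚ)[2] = 0`, `Δ_E` not a square: `2^{ω(N) − 1 + r + [Δ_E > 0 ∧ E(ℚ) ⊂ E⁰(ℝ)]} ∣ m_E`, `r = rank E(ℚ)` —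
i.e. `dim Sel₂^{rel ∞} ≥ r + [Δ>0] − [res_∞ ≠ 0 on E(ℚ)/2]`: when every rational point lies on the identity component of `E(ℝ)` (`¬ MeetsEgg`), the
real place contributes a power of `2` ON TOP of `2^{r}`; when `E(ℚ)` meets the egg it is absorbed (ES-35A's bit and Watkins' `2^r` overlap).
CENSUS (ENGINE 36c, Cremona `allgens ⨝ alldegphi`, curve #1, `N < 5·10⁵`, `4 ∤ N`, non-CM, `t₂ = 0`, `Δ` non-square, `r ≥ 1`): **645 252 / 645 252**;
the NEW cells (`Δ>0`, all generators on `E⁰(ℝ)`): rank 1: 39 851 / 39 851 (floor `ω+1` attained 4 594 = 11.5 %; the unraised floor `ω` attained 0 times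
where 3 662 would be expected), rank 2: 1 538 / 1 538 (floor `ω+2` attained 207), rank 3: 1 / 1; control cells attain their floors at 8.7–9.6 %.
Rank 0 (odd-order torsion lies on `E⁰(ℝ)`): the statement is ES-35A at `4 ∤ N` (80 482 / 80 482, -es g26).  MUTATIONS: dropping `¬ MeetsEgg` is refuted
9 266× (rank 1) + 5 220× (rank 2); `+2` instead of `+1` refuted 6 764×; at `4 ∣ N` the naive extension fails 829× (v₂N = 2…7) — hence `¬ 4 ∣ N`.
Why it might fail: a rank-3 curve with `Δ > 0` and all three generators on `E⁰(ℝ)` beyond `5·10⁵` (only ONE such curve in range); the component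
test is on generators of the full group `E(ℚ)` (saturation of Cremona's generators is assumed by the census, not by the statement).
[cite: Dummigan2006, §2 hypothesis (4) and §3 (L_∞)] [cite: CalegariEmerton2009, Thm. 1 (3b)] [cite: Watkins2002, Conj. 4.1] -/
@[conjecture] def MordellWeilRealComponentDivisibilityAtTwo : Prop :=
  ∀ (W : WeierstrassCurve ℚ) [W.IsElliptic] [W.IsGloballyMinimal] [NeZero (W.conductorNorm ℤ)]
    (D : ModularParametrizationData W (W.conductorNorm ℤ)),
    (∀ (W'' : WeierstrassCurve ℚ) [W''.IsElliptic] (D'' : ModularParametrizationData W'' (W.conductorNorm ℤ)),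
        D''.f = D.f → D.modularDegree ≤ D''.modularDegree) →
    ¬ 4 ∣ W.conductorNorm ℤ → ¬ W.HasCM → Nat.card (W.toAffine.Point[(2 : ℤ)]) = 1 → ¬ IsSquare W.Δ →
    2 ^ ((W.conductorNorm ℤ).primeFactors.card - 1 + W.mordellWeilRank + (if 0 < W.Δ ∧ ¬ MeetsEgg W then 1 else 0)) ∣ D.modularDegree

/-- **ES-36A `IdentityComponentDivisibilityAtTwo` — THE SLICE FORM (the crux's own hypotheses).**  For the crux's `W` (non-CM, surjective `2`-adic
image, odd torsion, odd Tamagawa product, analytic rank `1`) with `4 ∤ N` and `Δ_W > 0`: if NO rational point lies on the egg (`E(ℚ) ⊂ E⁰(ℝ)`, i.e. the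
generator is on the identity component), then `2^{ω(N) + 1} ∣ m_E` — ONE MORE power of `2` than the level floor with its real bit (`2^{ω(N)}`, ES-35A),
because on the slice `S(E) = {∞}` and `dim Sel₂^{rel ∞} = 1 − 0 + 1 = 2`.  Equivalently: a slice curve with `Δ > 0`, `4 ∤ N` and `v₂(m_E) = ω(N)` has its
generator ON THE EGG (ε = +1 in -an's AN-15 currency) — the modular degree READS the real component of the Heegner point.
CENSUS (ENGINE 36b/36c/36d, all `N < 5·10⁵`, rank-one optimal curves, `t₂ = 0`, `Δ` non-square, non-CM, `Δ > 0`, `4 ∤ N`): generator on `E⁰(ℝ)`: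
**39 851 / 39 851** with `v₂(m_E) ≥ ω+1` (odd-Tamagawa × odd-Ш_an sub-cell = the slice proper: 8 797 / 8 797, floor `ω+1` attained 3 254 = 37.0 %; odd-Tam ×
even-Ш_an 50 / 50); generator on the egg: 100 842 curves, `v₂(m_E) = ω` attained 9 266 times (odd-Tam cell: 37.2 %) — so the bit discriminates at full
strength; by range `N ≤ 10⁴` 332/0, `10⁴–10⁵` 6 230/0, `10⁵–4·10⁵` 24 748/0, `4·10⁵–5·10⁵` 8 541/0.  Exact integer component test `[x(P) ≥ e₁]`.
Why it might fail: a slice curve beyond `5·10⁵` with `Ш[2] ≠ 0` whose Ш-classes are real-trivial could sit at `ω+1` without the generator bit — the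
statement only claims `≥ ω+1`, so it fails only if some slice curve has `v₂(m_E) = ω(N)` with generator on `E⁰(ℝ)`.
[cite: Dummigan2006, §2 (4), §3] [cite: CalegariEmerton2009, Thm. 1 (3b), §3.2] [cite: GrossZagier1986, V (2.1)] -/
@[conjecture] def IdentityComponentDivisibilityAtTwo : Prop :=
  ∀ (W : WeierstrassCurve ℚ) [W.IsElliptic] [W.IsGloballyMinimal] [NeZero (W.conductorNorm ℤ)],
    ¬ W.HasCM → (∀ n : ℕ, W.HasSurjectiveModNGaloisRep ((2 ^ n : ℕ) : ℤ)) → Odd W.torsionOrder → Odd W.tamagawaProduct →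
    W.analyticRank = 1 →
    ∀ (D : ModularParametrizationData W (W.conductorNorm ℤ)),
    (∀ (W'' : WeierstrassCurve ℚ) [W''.IsElliptic] (D'' : ModularParametrizationData W'' (W.conductorNorm ℤ)),
        D''.f = D.f → D.modularDegree ≤ D''.modularDegree) →
    ¬ 4 ∣ W.conductorNorm ℤ → 0 < W.Δ → ¬ MeetsEgg W →
    2 ^ ((W.conductorNorm ℤ).primeFactors.card + 1) ∣ D.modularDegree

/-! ### Kernel glue (sorry-free) -/

/-- ES-36D ⟹ ES-36C: `max r σ ≥ σ`. -/
theorem evenTamagawa_of_rank (h : EvenTamagawaRankDivisibilityAtTwo) : EvenTamagawaDivisibilityAtTwo := by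
  intro W _ _ _ D hopt hsf ht2 hsq
  have h' := h W D hopt hsf ht2 hsq
  exact dvd_trans (pow_dvd_pow 2 (by omega)) h'

/-- The bridge the slice form needs from ES-36B: on the slice, «analytic rank 1 ⟹ Mordell–Weil rank 1» (Gross–Zagier–Kolyvagin) and the
crux's hypotheses discharge ES-36B's (`Odd #E(ℚ)_tors ⟹ E(ℚ)[2] = 0`; surjective mod 2 ⟹ `Δ` non-square).  Stated as the exact residual
implication so that the kernel certifies the exponent bookkeeping `ω − 1 + 1 + 1 = ω + 1`. -/
def SliceDischarge : Prop :=
  ∀ (W : WeierstrassCurve ℚ) [W.IsElliptic] [W.IsGloballyMinimal] [NeZero (W.conductorNorm ℤ)],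
    ¬ W.HasCM → (∀ n : ℕ, W.HasSurjectiveModNGaloisRep ((2 ^ n : ℕ) : ℤ)) → Odd W.torsionOrder → Odd W.tamagawaProduct →
    W.analyticRank = 1 → W.mordellWeilRank = 1 ∧ Nat.card (W.toAffine.Point[(2 : ℤ)]) = 1 ∧ ¬ IsSquare W.Δ

theorem identityComponent_of_mordellWeil (h : MordellWeilRealComponentDivisibilityAtTwo) (hs : SliceDischarge) :
    IdentityComponentDivisibilityAtTwo := by
  intro W _ _ _ hcm hsurj htor htam han D hopt h4 hΔ hegg
  obtain ⟨hr, ht2, hsq⟩ := hs W hcm hsurj htor htam han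
  have h' := h W D hopt h4 hcm ht2 hsq
  rw [hr, if_pos ⟨hΔ, hegg⟩] at h'
  -- exponent bookkeeping: `ω - 1 + 1 + 1 ≤ ω + 1` always, with equality when `ω ≥ 1`; divisibility transfers along `≤`.
  exact dvd_trans (pow_dvd_pow 2 (by omega)) h'

/-! ### ES-36F / ES-36G — the `E(ℚ)`-absorption term, measured EXACTLY with halving quartics (ENGINES 36m / 36n / 36p, -es g27)

For a field `K ⊇ ℚ` and a rational affine point `P = (x, y)` of infinite or odd order, `P ∈ 2E(K)` iff the HALVING QUARTIC
`X⁴ − b₄X² − 2b₆X − b₈ = x·(4X³ + b₂X² + 2b₄X + b₆)` has a root `X ∈ K` (`x(2Q) = X` for a half `Q`; if `x(Q) ∈ K` then `σQ = ±Q` for every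
`σ ∈ Aut(K̄/K)`, and `σQ = −Q` would give `2P = σP − P = 0`).  With `E(ℚ)[2] = 0` this decides the localisation maps
`E(ℚ)/2E(ℚ) → E(ℚ_v)/2E(ℚ_v)` (`v ∈ S(E)`) from the generators alone (Cremona `allgens`), with no descent.  Write
`rk_F(E) := rk(E(ℚ)/2 → ⊕_{v∈S(E)} E(ℚ_v)/2)`, `a(E) := #{v ∈ S(E) : E(ℚ) ⊄ 2E(ℚ_v)}`, `σ(E) = Σ_{v∈S(E)} d_v` (`evenTamagawaSignature`).
MEASURED LAW (MODEL L / L′; optimal semistable `E`, `E(ℚ)[2] = 0`, `Δ ∉ ℚ^{×2}`, `r ≥ 1`, `N < 5·10⁵`):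
  `v₂(m_E) ≥ ω(N) − 1 + r + σ(E) − min(rk_F(E), a′(E))`,  `a′ := Σ_{v∈S} min(rk_v, κ_v)`, `κ_v = 1` (`v ≠ 2`), `κ₂ = d₂`,
0 exceptions in 166 294 (`2 ∉ S`) + 87 006 (`2 ∈ S`) curves and the floor ATTAINED in all 75 + 79 populated cells `(r, sign Δ, #β, #γ, rk_F, a′)`, `n ≥ 30`
— i.e. an odd tier-γ prime (`d_q = 2`) lets rational points cancel AT MOST ONE of its two dimensions, `q = 2` lets them cancel `d₂`.
The two one-sided laws whose conjunction is MODEL L are typed: ES-36F (joint rank; equivalently a RANK-FREE count of halvable classes) and ES-36G (place count).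
TWO ENGINES per local bit: `∞` sign test vs critical-point test 91 408 / 91 408; tier β Silverman component parity vs quartic root 142 797 / 142 797
(at β, `E(ℚ_q)/2E(ℚ_q) ≅ Φ_q/2Φ_q`); tier γ component-odd ⟹ quartic-non-trivial 67 236 / 67 236; the `𝔽_q`-root finder against brute force 3 400 / 3 400. -/

/-- The halving quartic of abscissa `x` has a root in the field `K ⊇ ℚ`:  `∃ X ∈ K, X⁴ − b₄X² − 2b₆X − b₈ = x(4X³ + b₂X² + 2b₄X + b₆)`. -/
def HalvingQuarticSolvable (W : WeierstrassCurve ℚ) (K : Type*) [Field K] [CharZero K] (x : ℚ) : Prop :=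
  ∃ X : K, X ^ 4 - ((W.b₄ : ℚ) : K) * X ^ 2 - 2 * ((W.b₆ : ℚ) : K) * X - ((W.b₈ : ℚ) : K)
    = ((x : ℚ) : K) * (4 * X ^ 3 + ((W.b₂ : ℚ) : K) * X ^ 2 + 2 * ((W.b₄ : ℚ) : K) * X + ((W.b₆ : ℚ) : K))

/-- `E(ℚ) ⊂ 2E(K)` in halving-quartic form: every rational affine point is halvable in `E(K)` (under `E(ℚ)[2] = 0`: the localisation map
`E(ℚ)/2E(ℚ) → E(K)/2E(K)` is ZERO).  Used with `K = ℝ` (⟺ `E(ℚ) ⊂ E⁰(ℝ)` when `Δ > 0`) and `K = ℚ_q`. -/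
def LocallyHalvable (W : WeierstrassCurve ℚ) (K : Type*) [Field K] [CharZero K] : Prop :=
  ∀ x y : ℚ, W.toAffine.Nonsingular x y → HalvingQuarticSolvable W K x

/-- `E(ℚ) ⊂ 2E(ℚ_q)` (vacuous for non-prime `q`). -/
def LocallyHalvableAtPrime (W : WeierstrassCurve ℚ) (q : ℕ) : Prop :=
  ∀ hq : q.Prime, letI : Fact q.Prime := ⟨hq⟩; LocallyHalvable W ℚ_[q]

/-- `a(E) := #{v ∈ S(E) : E(ℚ) ⊄ 2E(ℚ_v)}` — the number of even-Tamagawa places HIT by the Mordell–Weil group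
(`∞` counts iff `Δ > 0` and some rational point lies on the egg). -/
def nonHalvablePlaceCount (W : WeierstrassCurve ℚ) : ℕ :=
  (if 0 < W.Δ ∧ ¬ LocallyHalvable W ℝ then 1 else 0)
    + ((evenTamagawaMultPrimes W).filter (fun q => ¬ LocallyHalvableAtPrime W q)).card

/-- `2E(ℚ)` inside the Mordell–Weil group (affine-point model of Mathlib). -/
def twiceMordellWeil (W : WeierstrassCurve ℚ) : AddSubgroup W.toAffine.Point :=
  ((2 • AddMonoidHom.id W.toAffine.Point : W.toAffine.Point →+ W.toAffine.Point)).range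

/-- `P ∈ E(ℚ)` is `S(E)`-LOCALLY HALVABLE: `P ∈ 2E(ℝ)` if `Δ > 0`, and `P ∈ 2E(ℚ_q)` for every `q ∈ β(E) ∪ γ(E)` (`O` is). -/
def SLocallyHalvablePoint (W : WeierstrassCurve ℚ) (P : W.toAffine.Point) : Prop :=
  ∀ (x y : ℚ) (h : W.toAffine.Nonsingular x y), P = WeierstrassCurve.Affine.Point.some x y h →
    (0 < W.Δ → HalvingQuarticSolvable W ℝ x) ∧
    ∀ q ∈ evenTamagawaMultPrimes W, ∀ hq : q.Prime, letI : Fact q.Prime := ⟨hq⟩; HalvingQuarticSolvable W ℚ_[q] x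

/-- `h_S(E) := #{c ∈ E(ℚ)/2E(ℚ) : c is S(E)-locally trivial} = 2^{r − rk_F(E)}` (`= #ker(E(ℚ)/2 → ⊕_{v∈S} E(ℚ_v)/2)` when `E(ℚ)[2] = 0`). -/
def halvableClassCount (W : WeierstrassCurve ℚ) : ℕ :=
  Nat.card {c : W.toAffine.Point ⧸ twiceMordellWeil W //
    ∃ P : W.toAffine.Point, (QuotientAddGroup.mk P : W.toAffine.Point ⧸ twiceMordellWeil W) = c ∧ SLocallyHalvablePoint W P}

/-- **ES-36F `HalvableClassesDivisibilityAtTwo` (MODEL F, semistable, RANK-FREE form).**  For an optimal semistable `E/ℚ` with `E(ℚ)[2] = 0`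
and `Δ_E ∉ ℚ^{×2}`:
  `2^{ω(N) − 1 + σ(E)} · h_S(E) ∣ m_E`,  `h_S(E) = #{c ∈ E(ℚ)/2E(ℚ) : c ∈ 2E(ℚ_v) for all v ∈ S(E)}`, `σ = evenTamagawaSignature`
(equivalently `v₂(m_E) ≥ ω − 1 + r + σ − rk_F`, the Poitou–Tate count of `dim Sel₂^{S(E)}` with `Sel₂` replaced by `E(ℚ)/2E(ℚ)`).
CENSUS (ENGINES 36m + 36p, Cremona `allgens ⨝ alldegphi`, optimal, `N < 5·10⁵`, `r ≥ 1`; `r = 0` is ES-36C): 214 909 (`2 ∉ S`, incl. `S = ∅`) + 87 006 (`2 ∈ S`)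
= **301 915 / 301 915, 0 exceptions**; attained 55 116× (`2 ∉ S`); NOT attained exactly in the cells where an odd tier-γ prime carries a 2-dimensional image
(e.g. `r = 2`, `Δ < 0`, `S = {q}` γ, `rk_F = 2`: 0 / 5 598 at the floor, all at `≥` floor `+ 1`) — that slack is ES-36G's content.
Why it might fail: beyond `5·10⁵` a curve whose `S`-relaxed classes come from `Ш[2]` rather than `E(ℚ)` in a way the modular degree does not see;
`h_S` uses `Nat.card` (Mordell–Weil finiteness makes it the true count).  Not in print: Dummigan–Krishnamoorthy 2013 Prop. 2.1 has no Selmer term.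
[cite: Watkins2002, Conj. 4.1] [cite: Dummigan2006, §2–3] [cite: DummiganKrishnamoorthy2013, Prop. 2.1] [cite: CalegariEmerton2009, Thm. 1] -/
@[conjecture] def HalvableClassesDivisibilityAtTwo : Prop :=
  ∀ (W : WeierstrassCurve ℚ) [W.IsElliptic] [W.IsGloballyMinimal] [NeZero (W.conductorNorm ℤ)]
    (D : ModularParametrizationData W (W.conductorNorm ℤ)),
    (∀ (W'' : WeierstrassCurve ℚ) [W''.IsElliptic] (D'' : ModularParametrizationData W'' (W.conductorNorm ℤ)),
        D''.f = D.f → D.modularDegree ≤ D''.modularDegree) →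
    Squarefree (W.conductorNorm ℤ) → Nat.card (W.toAffine.Point[(2 : ℤ)]) = 1 → ¬ IsSquare W.Δ →
    2 ^ ((W.conductorNorm ℤ).primeFactors.card - 1 + evenTamagawaSignature W) * halvableClassCount W ∣ D.modularDegree

/-- **ES-36G `PlacewiseHalvingDivisibilityAtTwo` (MODEL G, semistable, `c₂` odd).**  For an optimal semistable `E/ℚ` with `E(ℚ)[2] = 0`,
`Δ_E ∉ ℚ^{×2}` and `2 ∉ S(E)` (`2 ∤ N` or `v₂(Δ)` odd):
  `2^{ω(N) − 1 + r + σ(E) − a(E)} ∣ m_E`,  `a(E) = #{v ∈ S(E) : E(ℚ) ⊄ 2E(ℚ_v)}` (`nonHalvablePlaceCount`)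
— each even-Tamagawa place absorbs AT MOST ONE dimension of `E(ℚ)/2E(ℚ)`, however large the image there (an odd tier-γ prime has `d_q = 2`).
CENSUS (ENGINE 36n, optimal semistable, `2 ∉ S ≠ ∅`, `r ≥ 1`, `N < 5·10⁵`): **166 294 / 166 294, 0 exceptions**; together with ES-36F the floor
`ω − 1 + r + σ − min(rk_F, a)` is attained in all 75 populated cells.  MUTATIONS: dropping `2 ∉ S(E)` is REFUTED 213× (at `q = 2` a tier-γ image of rank 2
absorbs 2: cap `κ₂ = d₂`); «a γ prime absorbs `rk_F − #{γ fully hit}`» (MODEL K) is refuted 1 511×.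
Why it might fail: a curve with two rational points hitting one odd γ prime in both directions AND `v₂(m_E)` one below this floor beyond `5·10⁵`; the
cap-one phenomenon at odd γ has no mechanism yet (conjecturally the level-raising bit at a trivial prime `Frob_q = 1 ∈ GL₂(𝔽₂)` is rigid).
[cite: Watkins2002, Conj. 4.1] [cite: KilfordWiese2008, Thm. 1.3] [cite: Dummigan2006, §2–3] [cite: AgasheRibetStein2012, Thm. 2.1] -/
@[conjecture] def PlacewiseHalvingDivisibilityAtTwo : Prop :=
  ∀ (W : WeierstrassCurve ℚ) [W.IsElliptic] [W.IsGloballyMinimal] [NeZero (W.conductorNorm ℤ)]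
    (D : ModularParametrizationData W (W.conductorNorm ℤ)),
    (∀ (W'' : WeierstrassCurve ℚ) [W''.IsElliptic] (D'' : ModularParametrizationData W'' (W.conductorNorm ℤ)),
        D''.f = D.f → D.modularDegree ≤ D''.modularDegree) →
    Squarefree (W.conductorNorm ℤ) → Nat.card (W.toAffine.Point[(2 : ℤ)]) = 1 → ¬ IsSquare W.Δ → 2 ∉ evenTamagawaMultPrimes W →
    2 ^ ((W.conductorNorm ℤ).primeFactors.card - 1 + W.mordellWeilRank + evenTamagawaSignature W - nonHalvablePlaceCount W)
      ∣ D.modularDegree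

/-- ES-36F ⟹ ES-36C (drop the class-count factor). -/
theorem evenTamagawa_of_halvableClasses (h : HalvableClassesDivisibilityAtTwo) : EvenTamagawaDivisibilityAtTwo := by
  intro W _ _ _ D hopt hsf ht2 hsq
  exact dvd_trans (dvd_mul_right _ _) (h W D hopt hsf ht2 hsq)

/-! ## ES-36H — the sharp law: Tamagawa 2-LENGTH weights, DIMENSION absorption (ENGINES 36q / 36r2 / 36s, after REF1 §338 / REF2 R59b)

REF1's sharpening S338 (Ribet–Takahashi 1997 Thm 1 / Takahashi 2001: `v₂(m_E) ≥ Σ_{q∣N} ord₂ c_q`, a theorem at square-free `N`) replaces the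
tier-β weight `1` by the LENGTH `ord₂ c_q`; the -es absorption analysis replaces REF1's `max(r, ·)` by `r + · − a(E)` with an explicit local
recipe for the absorbing quotient `A_v` of `E(ℚ_v)/2E(ℚ_v)`:
* `v = ∞` (`Δ > 0`): `A_∞ = π₀(E(ℝ))` (class absorbed iff the point is on `E⁰(ℝ)` iff its halving quartic has a real root);
* `q` odd, tier γ (`E[2] ⊂ E(ℚ_q)`), any `c_q`: `A_q = Φ_q/2Φ_q` (component parity; the unit direction of `E(ℚ_q)/2E(ℚ_q)` is RIGID);
* `q` tier β (odd or `q = 2`): `A_q = Φ_q/2Φ_q` if `2 ∥ c_q` (⟺ `E[4]` ramified at `q`), and `A_q = 0` (nothing absorbs) if `4 ∣ c_q`;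
* `q = 2`, tier γ: the full halving class (`P ∈ 2E(ℚ₂)`; a proxy absorbing up to 3 directions — the data say exactly `1 + [2 ∥ c₂]` absorb).
Component parity of an integral point `P = (x, y)` reducing to the node of a split `I_n`: `k(P) = min(v_q(2y + a₁x + a₃), n/2)` (Silverman 1988,
local-height algorithm); non-split: the rational singular component generates `Φ_q(𝔽_q) ≅ ℤ/2`.
LAW (U): `v₂(m_E) ≥ ω(N) − 1 + r + [Δ>0] + Σ_{q∣N} ord₂ c_q + #γ − a(E)`, `a(E) = rk(E(ℚ)/2E(ℚ) → ⊕_{v∈S} A_v)`; rank-free: ES-36H below.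
CENSUS (`N < 5·10⁵`, optimal semistable, `E(ℚ)[2] = 0`, `Δ ∉ ℚ^{×2}`): `r ≥ 1`, `S ≠ ∅`: **253 300 / 0 violations, 68 489 at the floor, floor attained
in 147/147 (`2 ∉ S`) + 195/199 (`2 ∈ S`; the 4 exceptions are tier-γ-at-2 cells where the halving proxy over-absorbs) populated cells**;
`r ≥ 1`, `S = ∅`: 48 615 / 0 (floor `ω − 1 + r`); `r = 0`: **129 256 / 0, 36 362 at the floor, 88/88 cells**; total **431 171 / 0**.
Two-engine checks: `Σ_{q∈S} ord₂ c_q` (split test `−c₄c₆ ∈ ℚ_q^{×2}`, `c_q = n` or `2`) `=` `ord₂ ∏ c_p` of Cremona's `allbsd` on 382 556 / 382 556 curves;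
parity-vs-halving at tier β 142 797 / 142 797 (36f/36n).  POINTWISE DOMINATION on the same curves: (U) ⟹ REF1's `L♯` (`max(r, ·)`), ES-36F, ES-36G, ES-36C.
-/

/-- `E` has split multiplicative reduction at `q` iff `−c₄/c₆ ∈ ℚ_q^{×2}` (Tate; Silverman ATAEC V.5.3); as a unit-square test on `−c₄c₆`. -/
def IsSplitMultAt (W : WeierstrassCurve ℚ) (q : ℕ) [Fact q.Prime] : Prop := IsPadicSquare q (-(W.c₄ * W.c₆))

/-- `ord₂ c_q(E)` via the tree's `localTamagawaNumber` (0 at non-primes). -/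
def twoLengthAt (W : WeierstrassCurve ℚ) (q : ℕ) : ℕ :=
  if hq : q.Prime then
    (haveI : Fact q.Prime := ⟨hq⟩
     padicValNat 2 ((W.baseChange ℚ_[q]).localTamagawaNumber ℤ_[q]))
  else 0

/-- The Tamagawa 2-length `Σ_{q ∣ N} ord₂ c_q(E)` (REF1 S338 / Ribet–Takahashi term). -/
def tamagawaTwoLength (W : WeierstrassCurve ℚ) : ℕ := ∑ q ∈ (W.conductorNorm ℤ).primeFactors, twoLengthAt W q

/-- The affine point `(x, y)` (on a globally minimal model) is `q`-integral and reduces to the singular point mod `q`. -/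
def SingularReductionAt (W : WeierstrassCurve ℚ) (q : ℕ) (x y : ℚ) : Prop :=
  0 ≤ padicValRat q x ∧
  (2 * y + W.a₁ * x + W.a₃ = 0 ∨ 0 < padicValRat q (2 * y + W.a₁ * x + W.a₃)) ∧
  (3 * x ^ 2 + 2 * W.a₂ * x + W.a₄ - W.a₁ * y = 0 ∨ 0 < padicValRat q (3 * x ^ 2 + 2 * W.a₂ * x + W.a₄ - W.a₁ * y))

/-- The point `(x, y)` maps to the NON-trivial class of `Φ_q(𝔽_q)/2Φ_q(𝔽_q)` at a multiplicative prime `q` with `v_q(Δ)` even: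
non-split ⟹ any singular-reduction point; split `I_n` ⟹ `k = min(v_q(2y + a₁x + a₃), n/2)` odd (Silverman 1988 component formula). -/
def OddComponentAt (W : WeierstrassCurve ℚ) (q : ℕ) [Fact q.Prime] (x y : ℚ) : Prop :=
  SingularReductionAt W q x y ∧
    (IsSplitMultAt W q → Odd (min (padicValRat q (2 * y + W.a₁ * x + W.a₃)) (padicValRat q W.Δ / 2)))

/-- The class of `(x, y)` dies in the absorbing quotient `A_q` at the even-Tamagawa prime `q` (recipe in the section docstring). -/
def AbsorbedAt (W : WeierstrassCurve ℚ) (q : ℕ) (x y : ℚ) : Prop :=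
  ∀ hq : q.Prime, letI : Fact q.Prime := ⟨hq⟩;
    (q ∈ fullTwoTorsionMultPrimes W → (q = 2 → HalvingQuarticSolvable W ℚ_[q] x) ∧ (q ≠ 2 → ¬ OddComponentAt W q x y)) ∧
    (q ∉ fullTwoTorsionMultPrimes W → twoLengthAt W q = 1 → ¬ OddComponentAt W q x y)

/-- `P ∈ E(ℚ)` dies in every absorbing quotient `A_v`, `v ∈ S(E)` (the zero point does, vacuously). -/
def AbsorptionRigidPoint (W : WeierstrassCurve ℚ) (P : W.toAffine.Point) : Prop :=
  ∀ (x y : ℚ) (h : W.toAffine.Nonsingular x y), P = WeierstrassCurve.Affine.Point.some x y h →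
    (0 < W.Δ → HalvingQuarticSolvable W ℝ x) ∧ ∀ q ∈ evenTamagawaMultPrimes W, AbsorbedAt W q x y

/-- `#{c ∈ E(ℚ)/2E(ℚ) : c ↦ 0 in ⊕_{v ∈ S(E)} A_v}` (`= 2^{r − a(E)}` by Mordell–Weil). -/
def rigidClassCount (W : WeierstrassCurve ℚ) : ℕ :=
  Nat.card {c : W.toAffine.Point ⧸ twiceMordellWeil W //
    ∃ P : W.toAffine.Point, (QuotientAddGroup.mk P : W.toAffine.Point ⧸ twiceMordellWeil W) = c ∧ AbsorptionRigidPoint W P}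

/-- **ES-36H `TamagawaLengthAbsorptionDivisibilityAtTwo` (law U, rank-free, all semistable optimal curves).**  For an optimal semistable `E/ℚ`
with `E(ℚ)[2] = 0` and `Δ_E ∉ ℚ^{×2}`:
  `2^(ω(N) − 1 + [Δ>0] + Σ_{q∣N} ord₂ c_q + #γ(E)) · #{c ∈ E(ℚ)/2E(ℚ) : c ↦ 0 in every A_v, v ∈ S(E)} ∣ m_E`.
CENSUS (ENGINES 36r2 + 36m + 36s, Cremona `N < 5·10⁵`): **431 171 / 431 171, 0 exceptions** (`r ≥ 1`: 301 915; `r = 0`: 129 256); floor attained in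
147/147 + 195/199 + 88/88 populated cells.  Pointwise at least as strong as REF1's `L♯`, ES-36C, ES-36F, ES-36G on every curve of the census.
Why it might fail: at a tier-γ prime `2` the halving proxy absorbs up to three directions but only `1 + [2 ∥ c₂]` are ever used (134 + 82 + 50 + 52
curves one above the floor): the true `A₂` at γ₂ is a 2- resp. 1-dimensional quotient not identified here; and beyond `5·10⁵` a curve with `4 ∣ c_q` whose
odd-component generator nevertheless lowers `v₂(m_E)`.  Mechanism (heuristic only): `A_q ≠ 0` iff `E[4]` is ramified at `q` or `Frob_q = 1` on `E[2]`.
[cite: RibetTakahashi1997, Thm. 1] [cite: Takahashi2001, Thm. 2.3] [cite: Watkins2002, Conj. 4.1] [cite: Dummigan2006, §2–3] [cite: Silverman1988, Thm. 5.2] -/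
@[conjecture] def TamagawaLengthAbsorptionDivisibilityAtTwo : Prop :=
  ∀ (W : WeierstrassCurve ℚ) [W.IsElliptic] [W.IsGloballyMinimal] [NeZero (W.conductorNorm ℤ)]
    (D : ModularParametrizationData W (W.conductorNorm ℤ)),
    (∀ (W'' : WeierstrassCurve ℚ) [W''.IsElliptic] (D'' : ModularParametrizationData W'' (W.conductorNorm ℤ)),
        D''.f = D.f → D.modularDegree ≤ D''.modularDegree) →
    Squarefree (W.conductorNorm ℤ) → Nat.card (W.toAffine.Point[(2 : ℤ)]) = 1 → ¬ IsSquare W.Δ →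
    2 ^ ((W.conductorNorm ℤ).primeFactors.card - 1 + realComponentBit W + tamagawaTwoLength W + (fullTwoTorsionMultPrimes W).card)
      * rigidClassCount W ∣ D.modularDegree

/-- **ES-36H₀ `TamagawaLengthDivisibilityAtTwoRankZero`** — the rank-0 shadow (no Mordell–Weil term): `2^(ω(N) − 1 + [Δ>0] + Σ ord₂ c_q + #γ) ∣ m_E`
for optimal semistable `E` with `E(ℚ) [2] = 0`, `Δ ∉ ℚ^{×2}`, `rank E(ℚ) = 0`.  CENSUS 129 256 / 0, 36 362 at the floor (ENGINE 36s); = REF1's `L♯` at rank 0.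
Why it might fail: only the `Σ ord₂ c_q` part is a theorem (Ribet–Takahashi); the `ω − 1`, `[Δ>0]` and `#γ` summands ADDING to it is conjectural.
[cite: RibetTakahashi1997, Thm. 1] [cite: DummiganKrishnamoorthy2013, Prop. 2.1] [cite: KilfordWiese2008, Thm. 1.3] -/
@[conjecture] def TamagawaLengthDivisibilityAtTwoRankZero : Prop :=
  ∀ (W : WeierstrassCurve ℚ) [W.IsElliptic] [W.IsGloballyMinimal] [NeZero (W.conductorNorm ℤ)]
    (D : ModularParametrizationData W (W.conductorNorm ℤ)),
    (∀ (W'' : WeierstrassCurve ℚ) [W''.IsElliptic] (D'' : ModularParametrizationData W'' (W.conductorNorm ℤ)),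
        D''.f = D.f → D.modularDegree ≤ D''.modularDegree) →
    Squarefree (W.conductorNorm ℤ) → Nat.card (W.toAffine.Point[(2 : ℤ)]) = 1 → ¬ IsSquare W.Δ → W.mordellWeilRank = 0 →
    2 ^ ((W.conductorNorm ℤ).primeFactors.card - 1 + realComponentBit W + tamagawaTwoLength W + (fullTwoTorsionMultPrimes W).card)
      ∣ D.modularDegree

/-- ES-36H ⟹ ES-36H₀ (the class-count factor is dropped; no rank hypothesis is even needed for this direction). -/
theorem tamagawaLengthRankZero_of_absorption (h : TamagawaLengthAbsorptionDivisibilityAtTwo) :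
    TamagawaLengthDivisibilityAtTwoRankZero := by
  intro W _ _ _ D hopt hsf ht2 hsq _
  exact dvd_trans (dvd_mul_right _ _) (h W D hopt hsf ht2 hsq)

/-! ## ES-36I — THE PARITY BIT (after REF1 §338b `P♯`): at `Δ < 0` with no tier-γ place, absorption happens TWO BITS AT A TIME

REF1 §338b found `P♯: v₂(m_E) ≥ ω − 1 + max(r, τ + π)`, `π(E) = [Δ<0]·[γ(E) = ∅]·[#{q ∣ N non-split, v_q(Δ) odd} ≡ ω(N) (mod 2)]` (0 / 431 171).
ENGINE 36v (this seat) shows `π` is the `r = a(E)` face of a parity bit coupling the NON-SPLIT COUNT to the ABSORPTION RANK: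
  `b(E) := [Δ<0] · [γ(E) = ∅] · [ #{q ∈ S(E) : q non-split} + a(E) odd ]`,   `a(E) = rk(E(ℚ)/2E(ℚ) → ⊕_{v∈S} A_v) = r − log₂ rigidClassCount`,
and **law U♭: `v₂(m_E) ≥ ω(N) − 1 + r + τ(E) − a(E) + b(E)`** holds on 431 171 / 431 171 semistable optimal curves with `E(ℚ)[2] = 0`, `Δ ∉ ℚ^{×2}`
(`N < 5·10⁵`, all ranks), is attained in ALL 407 populated cells `(r, sign Δ, {(ord₂ c_v, tier)}, a, b)` (n ≥ 30), tight on 138 953 curves, and is pointwise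
≥ U (strictly on 47 560), ≥ P♯ (strictly on 42 067), ≥ max(U, P♯) (strictly on 8 585, of which 2 816 attained).  Equivalently, with `ε := [#non-split q ∈ S odd]`:
`v₂(m_E) ≥ ω − 1 + r + τ + ε − 2·⌊(a(E) + ε)/2⌋` — at `Δ < 0` without γ places the Mordell–Weil classes are absorbed in PAIRS (an alternating structure on
the relaxed quotient), while a real place (`Δ > 0`) or a γ place breaks the pairing and single bits absorb (no parity bit there: every such cell attains U).
Using the root number (`(−1)^r = −∏(−w_q)`, `w_q = −1` split: checked 431 171 / 431 171) `b` is REF1's `π` exactly when `r = a(E)`. -/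

/-- The non-split even-Tamagawa primes: `q ∥ N`, `v_q(Δ)` even, `E` NON-split multiplicative at `q` (so `c_q = 2`). -/
def nonSplitEvenTamagawaPrimes (W : WeierstrassCurve ℚ) : Finset ℕ :=
  (evenTamagawaMultPrimes W).filter (fun q => ∃ hq : q.Prime, ¬ @IsSplitMultAt W q ⟨hq⟩)

/-- The absorption rank `a(E) = r − log₂ #{c ∈ E(ℚ)/2E(ℚ) : c ↦ 0 in ⊕ A_v}`. -/
def absorptionRank (W : WeierstrassCurve ℚ) [W.IsElliptic] : ℕ := W.mordellWeilRank - Nat.log 2 (rigidClassCount W)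

/-- The parity bit `b(E) = [Δ<0]·[γ(E) = ∅]·[#(non-split even-Tamagawa primes) + a(E) odd]`. -/
def parityBitAtTwo (W : WeierstrassCurve ℚ) [W.IsElliptic] : ℕ :=
  if W.Δ < 0 ∧ fullTwoTorsionMultPrimes W = ∅ ∧ Odd ((nonSplitEvenTamagawaPrimes W).card + absorptionRank W) then 1 else 0

/-- **ES-36I `TamagawaLengthParityDivisibilityAtTwo` (law U♭ = law U + the parity bit).**  For an optimal semistable `E/ℚ` with `E(ℚ)[2] = 0`,
`Δ ∉ ℚ^{×2}`:  `2^(ω(N) − 1 + [Δ>0] + Σ_{q∣N} ord₂ c_q + #γ(E) + b(E)) · #{c ∈ E(ℚ)/2E(ℚ) : c ↦ 0 in ⊕_{v∈S} A_v} ∣ m_E`.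
CENSUS (ENGINE 36v on top of 36r3/36s, Cremona `N < 5·10⁵`, all ranks): **431 171 / 431 171, 0 exceptions; 407 / 407 cells attained; 138 953 tight**;
the bit fires on 47 560 curves (17 137 / 22 553 / 7 646 / 224 of rank 0 / 1 / 2 / 3); witnesses at the new floor 203b1, 209a1, 218a1, 345b1, 357d1 (`r = a = 1`,
one split β prime, `v₂(m_E) = ω + 1`).  Why it might fail: post hoc (found after REF1's `π`), so the first out-of-sample range (`5·10⁵ ≤ N < 10⁶`) is the
test; the bit is stated only where no γ place and no real period-halving interferes — a curve with `Δ < 0`, `γ = ∅`, `#ns + a` odd and `v₂(m_E) = ω − 1 + r + τ − a`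
kills it; with γ₂ present `a(E)` uses the halving proxy (irrelevant to `b`, which is then 0).
[cite: RibetTakahashi1997, Thm. 1] [cite: DummiganKrishnamoorthy2013, Prop. 2.1] [cite: Yazdani2011, Lemma 2.5] [cite: Watkins2002, Conj. 4.1] -/
@[conjecture] def TamagawaLengthParityDivisibilityAtTwo : Prop :=
  ∀ (W : WeierstrassCurve ℚ) [W.IsElliptic] [W.IsGloballyMinimal] [NeZero (W.conductorNorm ℤ)]
    (D : ModularParametrizationData W (W.conductorNorm ℤ)),
    (∀ (W'' : WeierstrassCurve ℚ) [W''.IsElliptic] (D'' : ModularParametrizationData W'' (W.conductorNorm ℤ)),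
        D''.f = D.f → D.modularDegree ≤ D''.modularDegree) →
    Squarefree (W.conductorNorm ℤ) → Nat.card (W.toAffine.Point[(2 : ℤ)]) = 1 → ¬ IsSquare W.Δ →
    2 ^ ((W.conductorNorm ℤ).primeFactors.card - 1 + realComponentBit W + tamagawaTwoLength W + (fullTwoTorsionMultPrimes W).card
          + parityBitAtTwo W) * rigidClassCount W ∣ D.modularDegree

/-- ES-36I ⟹ ES-36H (drop the parity bit). -/
theorem tamagawaLengthAbsorption_of_parity (h : TamagawaLengthParityDivisibilityAtTwo) :
    TamagawaLengthAbsorptionDivisibilityAtTwo := by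
  intro W _ _ _ D hopt hsf ht2 hsq
  refine dvd_trans ?_ (h W D hopt hsf ht2 hsq)
  exact mul_dvd_mul_right (pow_dvd_pow 2 (Nat.le_add_right _ _)) _

/-! ## ES-36J — THE SIGNED OBJECT AT A SPLIT TIER-γ PRIME 2: the absorbing quotient is the SIGN CHARACTER χ₋₄ of the Kummer class (ENGINE 36t)

At a split multiplicative prime `2` with `E[2] ⊂ E(ℚ₂)` the Kummer class of `P ∈ E(ℚ)` is ONE square class `u_P ∈ ℚ₂^×/ℚ₂^{×2} = ⟨2, −1, 5⟩ ≅ 𝔽₂³`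
(Tate: `ℚ₂(½P) = ℚ₂(√u_P)`; concretely `u_P` = the common non-trivial value of `cls(x(P) − e_i)` over the 2-adic 2-torsion abscissae `e_i`, trivial iff
`P ∈ 2E(ℚ₂)`; ENGINE 36t: the three classes span ≤ 1 dimension for 8 064 / 8 064 generators on split-γ₂ curves, and the 𝔽₂-rank of the `u_P` equals the
halving-quartic rank of ENGINE 36r2 on every such curve — two engines).  Of the three coordinate functionals val / sgn / five (`u = 2^a(−1)^b 5^c`), the data
single out **sgn = χ₋₄(unit part)** as THE absorbing functional, for EVERY `ord₂ c₂`:  law U♭ with `A₂ := 𝔽₂³/ker(sgn)`: `2 ∥ c₂`: 3 347 curves, 0 violations,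
25 / 25 cells attained, 1 298 tight; `4 ∣ c₂`: 2 845 curves, 0 violations, 20 / 20 cells, 1 055 tight; every other functional fails (val 251 + 120, five 223 + 181,
mixed ≥ 208 violations) and every 2-dimensional quotient misses the `a = 2` cell (121–178 curves one above).  So at split γ₂ the parametrisation sees neither
the component (valuation) nor the unramified direction of a rational point, but the character of `ℚ₂(√−1)`.  NON-split γ₂ (`c₂ = 2`; ≈ 4 800 curves) is NOT
covered: there `ℚ₂(½P)` can be biquadratic (4 812 generators with a 2-dimensional span) and the halving proxy of ES-36H (two absorbing directions on data) stands. -/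

/-- The Kummer class of abscissa `x` at `2` has ODD SIGN: for some 2-adic 2-torsion abscissa `e` (`4e³ + b₂e² + 2b₄e + b₆ = 0`), `x − e ∈ {−1, −5, −2, −10}·ℚ₂^{×2}`,
i.e. `x − e = 2^k·u` with `u` a 2-adic unit `≡ 3 (mod 4)` (a square class `x − e` never qualifies). -/
def KummerSignOddAtTwo (W : WeierstrassCurve ℚ) (x : ℚ) : Prop :=
  ∃ e : ℚ_[2], 4 * e ^ 3 + (W.b₂ : ℚ_[2]) * e ^ 2 + 2 * (W.b₄ : ℚ_[2]) * e + (W.b₆ : ℚ_[2]) = 0 ∧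
    ∃ c ∈ ({-1, -5, -2, -10} : Finset ℚ), IsSquare ((c : ℚ_[2]) * ((x : ℚ_[2]) - e))

/-- `AbsorbedAt` with the γ₂ clause sharpened at a SPLIT γ₂: the class dies in `A₂ = ⟨sgn⟩` iff its sign is even; non-split γ₂ keeps the halving proxy. -/
def AbsorbedAtSharp (W : WeierstrassCurve ℚ) (q : ℕ) (x y : ℚ) : Prop :=
  ∀ hq : q.Prime, letI : Fact q.Prime := ⟨hq⟩;
    (q ∈ fullTwoTorsionMultPrimes W →
        (q = 2 → (IsSplitMultAt W q → ¬ KummerSignOddAtTwo W x) ∧ (¬ IsSplitMultAt W q → HalvingQuarticSolvable W ℚ_[q] x)) ∧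
        (q ≠ 2 → ¬ OddComponentAt W q x y)) ∧
    (q ∉ fullTwoTorsionMultPrimes W → twoLengthAt W q = 1 → ¬ OddComponentAt W q x y)

/-- `P` dies in every sharpened absorbing quotient. -/
def AbsorptionRigidPointSharp (W : WeierstrassCurve ℚ) (P : W.toAffine.Point) : Prop :=
  ∀ (x y : ℚ) (h : W.toAffine.Nonsingular x y), P = WeierstrassCurve.Affine.Point.some x y h →
    (0 < W.Δ → HalvingQuarticSolvable W ℝ x) ∧ ∀ q ∈ evenTamagawaMultPrimes W, AbsorbedAtSharp W q x y

/-- `#{c ∈ E(ℚ)/2E(ℚ) : c ↦ 0 in ⊕_{v ∈ S(E)} A_v}` with `A₂ = ⟨sgn⟩` at a split γ₂. -/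
def rigidClassCountSharp (W : WeierstrassCurve ℚ) : ℕ :=
  Nat.card {c : W.toAffine.Point ⧸ twiceMordellWeil W //
    ∃ P : W.toAffine.Point, (QuotientAddGroup.mk P : W.toAffine.Point ⧸ twiceMordellWeil W) = c ∧ AbsorptionRigidPointSharp W P}

/-- **ES-36J `SignCharacterAbsorptionDivisibilityAtTwo`** — law U♭ with the split-γ₂ quotient `A₂ = ⟨χ₋₄ ∘ u⟩`:  for an optimal semistable `E/ℚ` with
`E(ℚ)[2] = 0`, `Δ ∉ ℚ^{×2}`:  `2^(ω(N) − 1 + [Δ>0] + Σ ord₂ c_q + #γ + b(E)) · #{c ∈ E(ℚ)/2E(ℚ) : c rigid♯} ∣ m_E`.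
CENSUS: = ES-36I off split-γ₂ curves (431 171 / 0, 407 / 407 cells); on the 6 192 split-γ₂ curves of ENGINE 36t: 0 violations, 45 / 45 cells attained, 2 353 tight
(the halving proxy of ES-36H/I: 1 516 tight there and 4 cells missed).  Why it might fail: pre-registered only in part (P36.8b predicted sgn at `4 ∣ c₂`; at `2 ∥ c₂`
the prediction was the pair (val, sgn) and the data chose sgn alone); first out-of-sample range `5·10⁵ ≤ N < 10⁶`; a split-γ₂ curve whose generator has
`u_P ∈ {2, 5, 10}·□` (even sign) and `v₂(m_E)` one below the rigid floor kills it.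
[cite: Silverman1994, Thm. V.5.3] [cite: RibetTakahashi1997, Thm. 1] [cite: Watkins2002, Conj. 4.1] -/
@[conjecture] def SignCharacterAbsorptionDivisibilityAtTwo : Prop :=
  ∀ (W : WeierstrassCurve ℚ) [W.IsElliptic] [W.IsGloballyMinimal] [NeZero (W.conductorNorm ℤ)]
    (D : ModularParametrizationData W (W.conductorNorm ℤ)),
    (∀ (W'' : WeierstrassCurve ℚ) [W''.IsElliptic] (D'' : ModularParametrizationData W'' (W.conductorNorm ℤ)),
        D''.f = D.f → D.modularDegree ≤ D''.modularDegree) →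
    Squarefree (W.conductorNorm ℤ) → Nat.card (W.toAffine.Point[(2 : ℤ)]) = 1 → ¬ IsSquare W.Δ →
    2 ^ ((W.conductorNorm ℤ).primeFactors.card - 1 + realComponentBit W + tamagawaTwoLength W + (fullTwoTorsionMultPrimes W).card
          + parityBitAtTwo W) * rigidClassCountSharp W ∣ D.modularDegree


/-! ## ES-36K — LAW H: HILBERT-SYMBOL ABSORPTION AT EVERY EVEN-TAMAGAWA PLACE (ENGINES 36w / 36x / 36y / 36z, 2026-08-30T08:40Z)

The ± object, place by place.  Refining ES-36H/I/J by the residue of `q mod 4`, the split/non-split type and the full local Kummer triple, the data on ALL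
431 171 optimal semistable curves with `E(ℚ)[2] = 0`, `Δ ∉ ℚ^{×2}`, `N < 5·10⁵` (ENGINE 36z, rows sha16 149be72579a64046) single out ONE law with
**0 violations, 154 792 curves at the floor, and the floor attained in 1 263 / 1 263 populated cells** `(r, sign Δ, {place types}, a)` (n ≥ 20; 1 896 / 1 911 for n ≥ 10),
against 1 232 / 1 271 for law U♭ + sign character (ES-36J) and 22 075 violations if the real place is removed (negative control):
* WEIGHTS `w_v`: `∞ ↦ [Δ>0]`; tier β `q ↦ ord₂ c_q`; SPLIT tier γ `q ↦ ord₂ c_q + 1`; NON-SPLIT tier γ `q ↦ 2 + [4 ∣ v_q(Δ)]` (also at `q = 2`).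
* ABSORBING FUNCTIONALS (the quotient `A_v` of `E(ℚ_v)/2` that the Mordell–Weil group can pay for): `∞`: the component `[P ∉ E⁰(ℝ)]`; NON-SPLIT β or γ (odd `q`):
  the component `[P ∉ E₀(ℚ_q)]`; SPLIT β: NOTHING (rank-2 curves with two split β primes both hit sit 2 above the U♭ floor: 463 + 34 + 56 curves, 0 tight);
  SPLIT γ at odd `q`: the HILBERT SYMBOL `(−1, u_P)_q = [q ≡ 3 (4)]·[P ∉ E₀(ℚ_q)]` of the Tate parameter class `u_P ∈ ℚ_q^×/t^ℤ` (at `q ≡ 1 (4)` nothing absorbs: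
  305 + 791 + 247 rank-1 curves hit the component and stay at the rigid floor); SPLIT γ at `2`: `(−1, u_P)₂ = χ₋₄(u_P)` (ES-36J); NON-SPLIT γ at `2`: the pair
  (component `= [κ_{T₀}(P) ≠ 1]`, sign `χ₋₄(κ_{T₁}(P))`) (ENGINE 36w: 6 606 curves, 31 / 31 cells).
* PARITY BIT `b♯(E) := [Δ < 0] · [every γ prime is ≡ 1 (mod 4)] · [#{non-split q ∈ S} + a(E) odd]` — the U♭ bit extended to curves with γ places: a γ place at a
  prime where `−1` is a non-square (`q ≡ 3 (4)` or `q = 2`) switches the pairing off (variants keeping it at split-only / non-split-only / `q = 2` γ places: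
  6 503 / 7 338 / 1 990 violations).
LAW H: `v₂(m_E) ≥ ω(N) − 1 + r + Σ_v w_v − a(E) + b♯(E)`, `a(E) = rk(E(ℚ)/2 → ⊕_v A_v)`; rank-free form below (`2^{r − a} = #rigid classes`).  Pointwise ≥ ES-36I/J
(strictly on 28 677 + curves); the rank-0 shadow (weights only) is tight in every single-γ-type cell for both signs of `Δ` except non-split `q ≡ 1 (4)` at `Δ < 0`,
where the parity bit supplies the observed `+1` (811 + 2 023 curves, 0 at the old floor). -/

/-- `#{q ∈ γ(E) : E non-split at q, 4 ∣ v_q(Δ)}` — the extra unit of weight at a non-split tier-γ prime with `v_q(Δ) ≡ 0 (mod 4)`. -/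
def nonSplitGammaQuarticCount (W : WeierstrassCurve ℚ) : ℕ :=
  ((fullTwoTorsionMultPrimes W).filter (fun q => (∃ hq : q.Prime, ¬ @IsSplitMultAt W q ⟨hq⟩) ∧ (4 : ℤ) ∣ padicValRat q W.Δ)).card

/-- LAW H absorption at an even-Tamagawa prime `q` for the point `(x, y)`: the class dies in `A_q` iff — tier γ at `2`: even Kummer sign, and (non-split) even
component; tier γ at odd `q`: split ⟹ `(−1, u_P)_q = 1`, i.e. even component when `q ≡ 3 (4)` (nothing to pay at `q ≡ 1 (4)`); non-split ⟹ even component;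
tier β: non-split ⟹ even component; split ⟹ nothing to pay. -/
def AbsorbedAtH (W : WeierstrassCurve ℚ) (q : ℕ) (x y : ℚ) : Prop :=
  ∀ hq : q.Prime, letI : Fact q.Prime := ⟨hq⟩;
    (q ∈ fullTwoTorsionMultPrimes W →
        (q = 2 → ¬ KummerSignOddAtTwo W x ∧ (¬ IsSplitMultAt W q → ¬ OddComponentAt W q x y)) ∧
        (q ≠ 2 → (IsSplitMultAt W q → q % 4 = 3 → ¬ OddComponentAt W q x y) ∧ (¬ IsSplitMultAt W q → ¬ OddComponentAt W q x y))) ∧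
    (q ∉ fullTwoTorsionMultPrimes W → ¬ IsSplitMultAt W q → ¬ OddComponentAt W q x y)

/-- `P` dies in every LAW-H absorbing quotient `A_v`, `v ∈ S(E)`. -/
def AbsorptionRigidPointH (W : WeierstrassCurve ℚ) (P : W.toAffine.Point) : Prop :=
  ∀ (x y : ℚ) (h : W.toAffine.Nonsingular x y), P = WeierstrassCurve.Affine.Point.some x y h →
    (0 < W.Δ → HalvingQuarticSolvable W ℝ x) ∧ ∀ q ∈ evenTamagawaMultPrimes W, AbsorbedAtH W q x y

/-- `#{c ∈ E(ℚ)/2E(ℚ) : c ↦ 0 in ⊕_{v ∈ S(E)} A_v}` for the LAW-H quotients (`= 2^{r − a(E)}`). -/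
def rigidClassCountH (W : WeierstrassCurve ℚ) : ℕ :=
  Nat.card {c : W.toAffine.Point ⧸ twiceMordellWeil W //
    ∃ P : W.toAffine.Point, (QuotientAddGroup.mk P : W.toAffine.Point ⧸ twiceMordellWeil W) = c ∧ AbsorptionRigidPointH W P}

/-- LAW-H absorption rank `a(E) = r − log₂ #(rigid classes)`. -/
def absorptionRankH (W : WeierstrassCurve ℚ) [W.IsElliptic] : ℕ := W.mordellWeilRank - Nat.log 2 (rigidClassCountH W)

/-- The LAW-H parity bit `b♯(E) = [Δ<0]·[∀ q ∈ γ(E), q ≡ 1 (mod 4)]·[#(non-split even-Tamagawa primes) + a(E) odd]` (a γ prime `q ≡ 3 (4)` or `q = 2` kills it). -/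
def parityBitH (W : WeierstrassCurve ℚ) [W.IsElliptic] : ℕ :=
  if W.Δ < 0 ∧ (∀ q ∈ fullTwoTorsionMultPrimes W, q % 4 = 1) ∧ Odd ((nonSplitEvenTamagawaPrimes W).card + absorptionRankH W) then 1 else 0

/-- **ES-36K `HilbertSymbolAbsorptionDivisibilityAtTwo` (LAW H, rank-free, all optimal semistable curves with `E(ℚ)[2] = 0`, `Δ ∉ ℚ^{×2}`).**
`2^(ω(N) − 1 + [Δ>0] + Σ_{q∣N} ord₂ c_q + #γ(E) + #{q ∈ γ non-split, 4 ∣ v_q(Δ)} + b♯(E)) · #{c ∈ E(ℚ)/2E(ℚ) : c ↦ 0 in ⊕_{v∈S} A_v} ∣ m_E`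
with the LAW-H quotients `A_v` (Hilbert symbol `(−1, u_P)_q` at split γ, component at non-split places and at `∞`, nothing at split β, (component, sign) at non-split γ₂).
CENSUS (ENGINE 36z = 36y + bit-vectors, two-engine pieces 36t/36w (2-adic Kummer triple vs halving quartic), 36x (q-adic Kummer vs Silverman component formula),
Cremona `N < 5·10⁵`, ranks 0–4): **431 171 / 431 171, 0 exceptions; 154 792 tight; 1 263 / 1 263 cells (n ≥ 20) attained; by rank 43 839 / 78 772 / 30 626 / 1 555 tight.**
Why it might fail: found by coordinate descent on this range (post hoc in the `q mod 4` and split-β refinements; pre-registered only for the γ₂ sign character), so the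
first out-of-sample range `5·10⁵ ≤ N < 10⁶` and the 15 thin non-attained cells (n = 10–14, three-place signatures) are the test; ONE optimal semistable curve with
`v₂(m_E)` below the LAW-H floor kills it — the cheapest candidates are rank-2 curves with `Δ > 0`, one split β prime and both functionals hit (1 859 curves sit exactly
1 above the U♭ floor = AT the LAW-H floor).
[cite: Silverman1994, Thm. V.5.3] [cite: RibetTakahashi1997, Thm. 1] [cite: Watkins2002, Conj. 4.1] [cite: DummiganKrishnamoorthy2013, Prop. 2.1] -/
@[conjecture] def HilbertSymbolAbsorptionDivisibilityAtTwo : Prop :=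
  ∀ (W : WeierstrassCurve ℚ) [W.IsElliptic] [W.IsGloballyMinimal] [NeZero (W.conductorNorm ℤ)]
    (D : ModularParametrizationData W (W.conductorNorm ℤ)),
    (∀ (W'' : WeierstrassCurve ℚ) [W''.IsElliptic] (D'' : ModularParametrizationData W'' (W.conductorNorm ℤ)),
        D''.f = D.f → D.modularDegree ≤ D''.modularDegree) →
    Squarefree (W.conductorNorm ℤ) → Nat.card (W.toAffine.Point[(2 : ℤ)]) = 1 → ¬ IsSquare W.Δ →
    2 ^ ((W.conductorNorm ℤ).primeFactors.card - 1 + realComponentBit W + tamagawaTwoLength W + (fullTwoTorsionMultPrimes W).card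
          + nonSplitGammaQuarticCount W + parityBitH W) * rigidClassCountH W ∣ D.modularDegree

/-- **ES-36K₀ `HilbertSymbolDivisibilityAtTwoRankZero`** — the rank-0 shadow of LAW H (weights + parity bit with `a = 0`; no Mordell–Weil term):
for optimal semistable `E` of Mordell–Weil rank 0 with `E(ℚ)[2] = 0`, `Δ ∉ ℚ^{×2}`:
`2^(ω − 1 + [Δ>0] + Σ ord₂ c_q + #γ + #{q ∈ γ non-split, 4 ∣ v_q(Δ)} + [Δ<0]·[∀ q∈γ, q ≡ 1 (4)]·[#non-split q ∈ S odd]) ∣ m_E`.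
CENSUS: 129 256 rank-0 curves, 0 exceptions, 43 839 tight (law U: 36 362); the `+1` at `Δ < 0` with a single non-split γ prime `q ≡ 1 (4)` holds on 811 + 2 023 curves with
0 at the old floor.  Why it might fail: the same out-of-sample test; one rank-0 curve below the floor kills it. [cite: Watkins2002, Conj. 4.1] [cite: ARS2006, Thm. 3.6] -/
@[conjecture] def HilbertSymbolDivisibilityAtTwoRankZero : Prop :=
  ∀ (W : WeierstrassCurve ℚ) [W.IsElliptic] [W.IsGloballyMinimal] [NeZero (W.conductorNorm ℤ)]
    (D : ModularParametrizationData W (W.conductorNorm ℤ)),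
    (∀ (W'' : WeierstrassCurve ℚ) [W''.IsElliptic] (D'' : ModularParametrizationData W'' (W.conductorNorm ℤ)),
        D''.f = D.f → D.modularDegree ≤ D''.modularDegree) →
    Squarefree (W.conductorNorm ℤ) → Nat.card (W.toAffine.Point[(2 : ℤ)]) = 1 → ¬ IsSquare W.Δ → W.mordellWeilRank = 0 →
    2 ^ ((W.conductorNorm ℤ).primeFactors.card - 1 + realComponentBit W + tamagawaTwoLength W + (fullTwoTorsionMultPrimes W).card
          + nonSplitGammaQuarticCount W
          + (if W.Δ < 0 ∧ (∀ q ∈ fullTwoTorsionMultPrimes W, q % 4 = 1) ∧ Odd (nonSplitEvenTamagawaPrimes W).card then 1 else 0)) ∣ D.modularDegree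

/-! ## ES-36L — LAW P: THE PARITY BIT IS A PAIRING CONDITION — it lives iff every `(−1)`-type paying functional is realised independently by rational points
(ENGINE 36z re-analyses `anat36z_an2.py` / `anat36z_an3.py` / `anat36z_an3b.py`, v8, 2026-08-30T09:45Z)

Splitting LAW H's cells by WHICH functionals the Mordell–Weil group pays exposes 19 + more populated cells where LAW H is never attained, and one law with
0 exceptions that attains all of them.  Sort the LAW-H paying functionals into two types:
* N-type (component-type): the component at a NON-split β prime (any `q`), at a non-split γ prime `q ≡ 1 (mod 4)`, and at a non-split γ prime `2`;
* K-type (`(−1)`-type — the places where `−1` is not a local square and `E` has full local 2-torsion): the real component (`Δ > 0`), the Hilbert symbol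
  `(−1,u_P)_q` at a split γ prime `q ≡ 3 (4)`, `χ₋₄(u_P)` at a split γ prime 2, `χ₋₄(κ_{T₁}(P))` at a non-split γ prime 2, the component at a non-split γ prime `q ≡ 3 (4)`.
LAW P: the parity bit is `b_P(E) = [#N-functionals + a_N(E) odd] · [all K-functionals are paid independently: rk(E(ℚ)/2 → ⊕ N ⊕ K) = a_N(E) + #K]`.
Its faces: `Δ < 0`, no γ prime with `−1` non-square (K = ∅): `b♯` of LAW H; rank 0: K must be empty (ES-36K₀'s bit); `Δ > 0` without such γ primes: the bit
lives iff the real functional is paid independently of the N-functionals (LAW H♯: 3 096 curves, e.g. rank 1, `{∞, non-split β}`, generator off `E⁰(ℝ)` and on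
`E₀(ℚ_q)`: 731 + 643 + 351 curves all exactly one above the LAW-H floor); with γ primes `q ≡ 3 (4)` / `2`: LAW H's «kill» was the unpaid case — paid
independently they keep the pairing alive (1 660 curves: 1 515 rank-1 and 127 rank-2 at `Δ < 0`, 18 rank-2 at `Δ > 0`).  Pointwise LAW H ≤ LAW H♯ ≤ LAW P
(bits on 34 780 ⊂ 37 876 ⊂ 39 536 curves). -/

/-- `P ↦ 0` in every N-type (component-type) paying quotient at `q`: the component at a non-split β prime, at a non-split γ prime `q ≡ 1 (mod 4)`,
at a non-split γ prime `2` (vacuous at split primes and at non-split γ primes `q ≡ 3 (mod 4)`, whose functionals are K-type). -/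
def AbsorbedAtN (W : WeierstrassCurve ℚ) (q : ℕ) (x y : ℚ) : Prop :=
  ∀ hq : q.Prime, letI : Fact q.Prime := ⟨hq⟩;
    ¬ IsSplitMultAt W q → (q ∉ fullTwoTorsionMultPrimes W ∨ q = 2 ∨ q % 4 = 1) → ¬ OddComponentAt W q x y

/-- `P` dies in every N-type paying quotient. -/
def AbsorptionRigidPointN (W : WeierstrassCurve ℚ) (P : W.toAffine.Point) : Prop :=
  ∀ (x y : ℚ) (h : W.toAffine.Nonsingular x y), P = WeierstrassCurve.Affine.Point.some x y h →
    ∀ q ∈ evenTamagawaMultPrimes W, AbsorbedAtN W q x y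

/-- `#{c ∈ E(ℚ)/2E(ℚ) : c ↦ 0 in ⊕ N-type quotients}` (`= 2^{r − a_N(E)}`). -/
def rigidClassCountN (W : WeierstrassCurve ℚ) : ℕ :=
  Nat.card {c : W.toAffine.Point ⧸ twiceMordellWeil W //
    ∃ P : W.toAffine.Point, (QuotientAddGroup.mk P : W.toAffine.Point ⧸ twiceMordellWeil W) = c ∧ AbsorptionRigidPointN W P}

/-- `a_N(E) = rk(E(ℚ)/2E(ℚ) → ⊕ N-type quotients)`. -/
def absorptionRankN (W : WeierstrassCurve ℚ) [W.IsElliptic] : ℕ := W.mordellWeilRank - Nat.log 2 (rigidClassCountN W)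

/-- Number of N-type functionals = number of non-split even-Tamagawa primes that are β, or γ with `q = 2` or `q ≡ 1 (mod 4)`. -/
def nTypeCount (W : WeierstrassCurve ℚ) : ℕ :=
  ((evenTamagawaMultPrimes W).filter (fun q =>
      (∃ hq : q.Prime, ¬ @IsSplitMultAt W q ⟨hq⟩) ∧ (q ∉ fullTwoTorsionMultPrimes W ∨ q = 2 ∨ q % 4 = 1))).card

/-- Number of K-type functionals = `[Δ > 0] + #{q ∈ γ(E) : q = 2 ∨ q ≡ 3 (mod 4)}` (one per such place, split or not). -/
def kTypeCount (W : WeierstrassCurve ℚ) : ℕ :=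
  realComponentBit W + ((fullTwoTorsionMultPrimes W).filter (fun q => q = 2 ∨ q % 4 = 3)).card

/-- LAW-P pairing bit `b_P(E) = [#N + a_N(E) odd] · [rk(E(ℚ)/2 → ⊕ N ⊕ K) = a_N(E) + #K]`; the second factor says every K-type functional is paid and the
K-functionals are independent of each other and of the N-functionals (as classes: `#rigid_N = 2^{#K} · #rigid_{N ∪ K}`). -/
def pairingBit (W : WeierstrassCurve ℚ) [W.IsElliptic] : ℕ :=
  if Odd (nTypeCount W + absorptionRankN W) ∧ rigidClassCountN W = 2 ^ kTypeCount W * rigidClassCountH W then 1 else 0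

/-- **ES-36L `SymbolPairingParityDivisibilityAtTwo` (LAW P ⊇ LAW H).**  LAW H's weights and absorbing quotients with the pairing bit `b_P` in place of `b♯`:
`2^(ω(N) − 1 + [Δ>0] + Σ_{q∣N} ord₂ c_q + #γ + #{q ∈ γ non-split, 4 ∣ v_q(Δ)} + b_P(E)) · #{c ∈ E(ℚ)/2E(ℚ) rigid in ⊕_{v∈S} A_v} ∣ m_E`.
CENSUS (Cremona `N < 5·10⁵`; 431 171 optimal semistable curves with `E(ℚ)[2] = 0`, `Δ ∉ ℚ^{×2}`, ranks 0–4; bit-vectors of ENGINE 36z; two engines per local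
functional as in ES-36K): **0 exceptions; 156 268 tight (LAW H 154 792), by rank 43 839 / 80 101 / 30 773 / 1 555; `b_P = 1` on 39 536 curves (b♯: 34 780); cells `(r, sign Δ, place signature, a_N,
a − a_N)` with n ≥ 20: 1 294 / 1 294 attained** (LAW H on the key `(…, a_fin, real pays)`: 1 276 / 1 295).  Controls (same engine): the non-split γ `q ≡ 3 (4)`
component declared N-type: 4 247 violations (517b1, 1786c1 …); the split γ `q ≡ 3 (4)` symbol declared N-type: 5 381 (437b1, 517a1 …); the non-split γ₂ sign
declared N-type: 1 024 (1006a1, 3118a1 …); the non-split γ₂ component declared K-type: 0 violations but pointwise weaker (bit on 363 fewer curves, all ≥ 1 above);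
bit without the independence factor at rank 0, `Δ > 0`: 1 610.  Witnesses at the new floor: 1466a1, 3515a1, 3995d1, 5318a1 (real place paid alone).
Why it might fail: post hoc — found by re-keying LAW H's cells by the paid functionals; the frozen out-of-sample predictions (seat NOTES `## predictions (4)`,
LMFDB `5·10⁵ ≤ N < 10⁶`) decide; ONE optimal semistable curve below the floor kills it — cheapest class: rank 1, `Δ > 0`, one non-split β prime, no γ prime,
generator `P ∉ E⁰(ℝ)`, `P ∈ E₀(ℚ_q)`, which LAW P puts one above LAW H (2 052 curves in range: 0 at the LAW-H floor, 598 at the LAW-P floor).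
[cite: Silverman1994, Thm. V.5.3] [cite: RibetTakahashi1997, Thm. 1] [cite: Watkins2002, Conj. 4.1] [cite: DummiganKrishnamoorthy2013, Prop. 2.1] -/
@[conjecture] def SymbolPairingParityDivisibilityAtTwo : Prop :=
  ∀ (W : WeierstrassCurve ℚ) [W.IsElliptic] [W.IsGloballyMinimal] [NeZero (W.conductorNorm ℤ)]
    (D : ModularParametrizationData W (W.conductorNorm ℤ)),
    (∀ (W'' : WeierstrassCurve ℚ) [W''.IsElliptic] (D'' : ModularParametrizationData W'' (W.conductorNorm ℤ)),
        D''.f = D.f → D.modularDegree ≤ D''.modularDegree) →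
    Squarefree (W.conductorNorm ℤ) → Nat.card (W.toAffine.Point[(2 : ℤ)]) = 1 → ¬ IsSquare W.Δ →
    2 ^ ((W.conductorNorm ℤ).primeFactors.card - 1 + realComponentBit W + tamagawaTwoLength W + (fullTwoTorsionMultPrimes W).card
          + nonSplitGammaQuarticCount W + pairingBit W) * rigidClassCountH W ∣ D.modularDegree

end Summit.BirchSwinnertonDyer.BirchSwinnertonDyer.Theorems.RankOneAtTwoRelaxedSelmer

end
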